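import Mathlib.Analysis.SpecialFunctions.Pow.Real
import Literature.Probability.LatticeModels.LatticeBootstrapFeasible
import Literature.Probability.LatticeModels.RandomCurrentsProofs
import HarnessLib

/-!
# The reflection-positivity rows make the axial two-point values of a row-feasible functional log-convex

Topic `Probability/LatticeModels`, namespace `Literature.Probability.LatticeModels`. Theorem-only
file (no definitions, no named facts): proved API of `LatticeBootstrapFeasible`
(`LatticeBootstrapFeasible.lean`, the hypothesis rows of the lattice Ising bootstrap at `d = 3`,
`β = β_c(3)`, Cho–Sun 2023 Def. 12 with the four lattice mirrors of Fröhlich–Israel–Lieb–Simon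
1978). For an ARBITRARY row-feasible level-`L` functional `E` (`LatticeBootstrapFeasible L cw Cw E`,
`cw > 0`) — in particular every boundary-law mixture functional `boundaryLawFunctional 3 L β_c ν`
that is feasible — write `g(n) = E{0, n e₁}`:

* `LatticeBootstrapFeasible.rp_pair` — row 3 (reflection positivity, matrix form) on the
  two-element family of singletons `{x}, {y}` in the closed half-space of a lattice mirror `θ`:
  the `2 × 2` matrix `(E({u} ∆ θ{v}))_{u,v ∈ {x,y}}` is positive semidefinite (one test vector).
* `LatticeBootstrapFeasible.axis_logConvex` — **`g(n+1)² ≤ g(n) g(n+2)` for `1 ≤ n`,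
  `n + 2 ≤ L`**: for even `n = 2a` the SITE mirror `x₀ ↦ -x₀` with the family
  `{a e₁}, {(a+1) e₁}`, for odd `n = 2a + 1` the BOND mirror `x₀ ↦ 1 - x₀` with
  `{(a+1) e₁}, {(a+2) e₁}`; in-box translation invariance (row 1) turns `E{u e₁, v e₁}` into
  `g(u - v)`, and the `2 × 2` minor is the claim (positivity of `g(n)` from the window row 8).
  This is the finite-level, mixture-of-finite-volume-states shadow of the Källén–Lehmann /
  transfer-matrix representation `g(n) = ∫ λⁿ dρ(λ)` of reflection-positive states
  (Fröhlich–Israel–Lieb–Simon 1978, Thm. 2.1 and §3; Glimm–Jaffe, *Quantum Physics*, §6.2),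
  obtained from the rows alone, with no infinite-volume limit and no spectral theory.
* `LatticeBootstrapFeasible.axis_ratio_mono` — equivalently the one-step ratios `g(n+1)/g(n)`
  are non-decreasing in `n` on `{1, …, L-1}`.

## References

* J. Fröhlich, R. Israel, E. H. Lieb, B. Simon, *Phase transitions and reflection positivity. I*,
  Comm. Math. Phys. 62 (1978) 1–34, Thm. 2.1, §3 [FrohlichIsraelLiebSimon1978].
* M. Cho, X. Sun, JHEP 11 (2023) 047, Def. 12 [ChoSun2023].
-/

namespace Literature.Probability.LatticeModels

open Finset

/-! ### Row 3 on a two-element family of singletons -/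

/-- **Reflection positivity on two singletons.** For a row-feasible `E`, a lattice mirror
`(θ, ℓ)` of one of the four types, sites `x, y ∈ Λ_L` in the closed half-space `ℓ ≥ 0`, and
reals `c₀, c₁`: `0 ≤ c₀² E({x} ∆ {θx}) + c₀c₁ E({x} ∆ {θy}) + c₁c₀ E({y} ∆ {θx}) + c₁² E({y} ∆ {θy})`
(row 3 with the family `![{x}, {y}]`). [cite: ChoSun2023, Def. 12 (Reflection positivity)] -/
theorem LatticeBootstrapFeasible.rp_pair {L : ℕ} {cw Cw : ℝ} {E : Finset (Site 3) → ℝ}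
    (hE : LatticeBootstrapFeasible L cw Cw E) {θ : Site 3 → Site 3} {ℓ : Site 3 → ℤ}
    (hθ : ∃ i j : Fin 3, i ≠ j ∧
      ((θ = fun x => Function.update x i (-x i)) ∧ (ℓ = fun x => x i) ∨
       (θ = fun x => Function.update x i (1 - x i)) ∧ (ℓ = fun x => 2 * x i - 1) ∨
       (θ = fun x => x ∘ Equiv.swap i j) ∧ (ℓ = fun x => x i - x j) ∨
       (θ = fun x => Function.update (Function.update x i (-x j)) j (-x i)) ∧
         (ℓ = fun x => x i + x j)))
    {x y : Site 3} (hx : x ∈ box 3 L) (hy : y ∈ box 3 L) (hℓx : 0 ≤ ℓ x) (hℓy : 0 ≤ ℓ y)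
    (c₀ c₁ : ℝ) :
    0 ≤ c₀ * c₀ * E (symmDiff {x} {θ x}) + c₀ * c₁ * E (symmDiff {x} {θ y}) +
      c₁ * c₀ * E (symmDiff {y} {θ x}) + c₁ * c₁ * E (symmDiff {y} {θ y}) := by
  have h := hE.reflectionPositive hθ (m := 2) ![{x}, {y}] ![c₀, c₁] (by
    intro a
    fin_cases a
    · exact ⟨by simpa using hx, by simpa using hℓx⟩
    · exact ⟨by simpa using hy, by simpa using hℓy⟩)
  simpa [Fin.sum_univ_two, Finset.image_singleton, add_assoc] using h

/-! ### Axis geometry of the site and bond mirrors -/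

/-- `u e₁ ∈ Λ_L` for an integer `u` with `|u| ≤ L`. [folklore] -/
theorem axisSite_int_mem_box {L : ℕ} {u : ℤ} (h1 : -(L : ℤ) ≤ u) (h2 : u ≤ L) :
    (Pi.single 0 u : Site 3) ∈ box 3 L := by
  rw [mem_box]
  intro i
  by_cases hi : i = 0
  · subst hi; simp only [Pi.single_eq_same]; omega
  · simp only [Pi.single_eq_of_ne hi]; omega

/-- The site mirror `x₀ ↦ -x₀` on the axis: `θ(u e₁) = (-u) e₁`. [folklore] -/
theorem siteMirror_apply_axisSite (u : ℤ) :
    (fun x : Site 3 => Function.update x 0 (-x 0)) (Pi.single 0 u) = Pi.single 0 (-u) := by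
  ext i
  by_cases hi : i = 0
  · subst hi; simp
  · simp [Function.update_of_ne hi, Pi.single_eq_of_ne hi]

/-- The bond mirror `x₀ ↦ 1 - x₀` on the axis: `θ(u e₁) = (1-u) e₁`. [folklore] -/
theorem bondMirror_apply_axisSite (u : ℤ) :
    (fun x : Site 3 => Function.update x 0 (1 - x 0)) (Pi.single 0 u) = Pi.single 0 (1 - u) := by
  ext i
  by_cases hi : i = 0
  · subst hi; simp
  · simp [Function.update_of_ne hi, Pi.single_eq_of_ne hi]

/-- Distinct integers give distinct axis sites. [folklore] -/
theorem axisSite_int_ne {u v : ℤ} (h : u ≠ v) : (Pi.single 0 u : Site 3) ≠ Pi.single 0 v := by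
  intro h'
  have := congrFun h' 0
  simp only [Pi.single_eq_same] at this
  exact h this

/-- **Row 1 on an axis pair**: `E{u e₁, v e₁} = E{0, (u - v) e₁}` for `v ≤ u`, both sites and
`(u-v) e₁` in `Λ_L` (translate by `-v e₁`). [cite: ChoSun2023, Def. 12 (Symmetry)] -/
theorem LatticeBootstrapFeasible.axisPair_eq {L : ℕ} {cw Cw : ℝ} {E : Finset (Site 3) → ℝ}
    (hE : LatticeBootstrapFeasible L cw Cw E) {u v : ℤ}
    (hu1 : -(L : ℤ) ≤ u) (hu2 : u ≤ L) (hv1 : -(L : ℤ) ≤ v) (hv2 : v ≤ L)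
    (hd : u - v ≤ L) (hvu : v ≤ u) :
    E {Pi.single 0 u, Pi.single 0 v} = E {0, Pi.single 0 (u - v)} := by
  have hA : ({Pi.single 0 u, Pi.single 0 v} : Finset (Site 3)) ⊆ box 3 L := by
    rw [Finset.insert_subset_iff, Finset.singleton_subset_iff]
    exact ⟨axisSite_int_mem_box hu1 hu2, axisSite_int_mem_box hv1 hv2⟩
  have himg : ({Pi.single 0 u, Pi.single 0 v} : Finset (Site 3)).image
      (· + Pi.single 0 (-v)) = {Pi.single 0 (u - v), 0} := by
    rw [Finset.image_insert, Finset.image_singleton, ← Pi.single_add, ← Pi.single_add,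
      add_neg_cancel, Pi.single_zero, ← sub_eq_add_neg]
  have hAv : ({Pi.single 0 u, Pi.single 0 v} : Finset (Site 3)).image
      (· + Pi.single 0 (-v)) ⊆ box 3 L := by
    rw [himg, Finset.insert_subset_iff, Finset.singleton_subset_iff]
    exact ⟨axisSite_int_mem_box (by omega) hd, zero_mem_box 3 L⟩
  have h := hE.translation_invariant hA hAv
  rw [himg, Finset.pair_comm] at h
  exact h.symm

/-! ### Log-convexity of the axial two-point values -/


/-- From a positive-semidefinite `2 × 2` pattern: `0 ≤ r·r·p + r·(-p)·r + (-p)·r·r + (-p)·(-p)·s`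
with `p > 0` gives `r² ≤ p s`. [folklore] -/
theorem sq_le_mul_of_psd_two {p r s : ℝ} (hp : 0 < p)
    (h : 0 ≤ r * r * p + r * (-p) * r + (-p) * r * r + (-p) * (-p) * s) : r ^ 2 ≤ p * s := by
  have h' : 0 ≤ p * (p * s - r ^ 2) := by nlinarith [h]
  nlinarith [(mul_nonneg_iff_of_pos_left hp).1 h']

/-- **Log-convexity of the axial two-point values of a feasible functional.** If
`LatticeBootstrapFeasible L cw Cw E` with `cw > 0`, then for `1 ≤ n`, `n + 2 ≤ L`:
`E{0,(n+1)e₁}² ≤ E{0,n e₁} · E{0,(n+2)e₁}`. Proof: reflection positivity (row 3) for the site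
mirror `x₀ ↦ -x₀` (even `n = 2a`, family `{a e₁}, {(a+1)e₁}`) resp. the bond mirror
`x₀ ↦ 1-x₀` (odd `n = 2a-1`, same family), in-box translation invariance (row 1) and positivity of
`E{0, n e₁}` (row 8). [cite: FrohlichIsraelLiebSimon1978, Thm. 2.1 (reflection positivity of n.n. Ising; Källén–Lehmann shadow)] -/
theorem LatticeBootstrapFeasible.axis_logConvex {L : ℕ} {cw Cw : ℝ} {E : Finset (Site 3) → ℝ}
    (hE : LatticeBootstrapFeasible L cw Cw E) (hcw : 0 < cw) {n : ℕ} (hn : 1 ≤ n)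
    (hnL : n + 2 ≤ L) :
    E {0, Pi.single 0 ((n + 1 : ℕ) : ℤ)} ^ 2 ≤
      E {0, Pi.single 0 (n : ℤ)} * E {0, Pi.single 0 ((n + 2 : ℕ) : ℤ)} := by
  have hpos : 0 < E {0, Pi.single 0 (n : ℤ)} :=
    hE.twoPoint_pos hcw (axisSite_int_mem_box (by omega) (by omega)) (by rw [Ne, ← Pi.single_zero (0 : Fin 3)]; exact axisSite_int_ne (by omega))
  rcases Nat.even_or_odd n with ⟨a, ha⟩ | ⟨a, ha⟩
  · -- even `n = a + a`, site mirror, family `{a e₁}, {(a+1) e₁}`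
    have ha1 : 1 ≤ a := by omega
    set θ : Site 3 → Site 3 := fun x => Function.update x 0 (-x 0) with hθdef
    set ℓ : Site 3 → ℤ := fun x => x 0 with hℓdef
    have hθ : ∃ i j : Fin 3, i ≠ j ∧
        ((θ = fun x => Function.update x i (-x i)) ∧ (ℓ = fun x => x i) ∨
         (θ = fun x => Function.update x i (1 - x i)) ∧ (ℓ = fun x => 2 * x i - 1) ∨
         (θ = fun x => x ∘ Equiv.swap i j) ∧ (ℓ = fun x => x i - x j) ∨
         (θ = fun x => Function.update (Function.update x i (-x j)) j (-x i)) ∧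
           (ℓ = fun x => x i + x j)) :=
      ⟨0, 1, by decide, Or.inl ⟨rfl, rfl⟩⟩
    have hx : (Pi.single 0 (a : ℤ) : Site 3) ∈ box 3 L := axisSite_int_mem_box (by omega) (by omega)
    have hy : (Pi.single 0 ((a : ℤ) + 1) : Site 3) ∈ box 3 L :=
      axisSite_int_mem_box (by omega) (by omega)
    have h := hE.rp_pair hθ hx hy (by simp [hℓdef]) (by simp [hℓdef]; omega)
      (E {0, Pi.single 0 ((n + 1 : ℕ) : ℤ)}) (-E {0, Pi.single 0 (n : ℤ)})
    -- evaluate the four symmetric differences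
    have e1 : θ (Pi.single 0 (a : ℤ)) = Pi.single 0 (-(a : ℤ)) := siteMirror_apply_axisSite _
    have e2 : θ (Pi.single 0 ((a : ℤ) + 1)) = Pi.single 0 (-((a : ℤ) + 1)) := siteMirror_apply_axisSite _
    rw [e1, e2,
      Current.symmDiff_singleton_eq_pair (axisSite_int_ne (by omega)),
      Current.symmDiff_singleton_eq_pair (axisSite_int_ne (by omega)),
      Current.symmDiff_singleton_eq_pair (axisSite_int_ne (by omega)),
      Current.symmDiff_singleton_eq_pair (axisSite_int_ne (by omega)),
      hE.axisPair_eq (by omega) (by omega) (by omega) (by omega) (by omega) (by omega),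
      hE.axisPair_eq (by omega) (by omega) (by omega) (by omega) (by omega) (by omega),
      hE.axisPair_eq (by omega) (by omega) (by omega) (by omega) (by omega) (by omega),
      hE.axisPair_eq (by omega) (by omega) (by omega) (by omega) (by omega) (by omega)]
      at h
    have c1 : (a : ℤ) - -(a : ℤ) = (n : ℤ) := by omega
    have c2 : (a : ℤ) - -((a : ℤ) + 1) = ((n + 1 : ℕ) : ℤ) := by push_cast; omega
    have c3 : (a : ℤ) + 1 - -(a : ℤ) = ((n + 1 : ℕ) : ℤ) := by push_cast; omega
    have c4 : (a : ℤ) + 1 - -((a : ℤ) + 1) = ((n + 2 : ℕ) : ℤ) := by push_cast; omega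
    rw [c1, c2, c3, c4] at h
    exact sq_le_mul_of_psd_two hpos h
  · -- odd `n = 2a + 1`, bond mirror, family `{(a+1) e₁}, {(a+2) e₁}`
    set θ : Site 3 → Site 3 := fun x => Function.update x 0 (1 - x 0) with hθdef
    set ℓ : Site 3 → ℤ := fun x => 2 * x 0 - 1 with hℓdef
    have hθ : ∃ i j : Fin 3, i ≠ j ∧
        ((θ = fun x => Function.update x i (-x i)) ∧ (ℓ = fun x => x i) ∨
         (θ = fun x => Function.update x i (1 - x i)) ∧ (ℓ = fun x => 2 * x i - 1) ∨
         (θ = fun x => x ∘ Equiv.swap i j) ∧ (ℓ = fun x => x i - x j) ∨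
         (θ = fun x => Function.update (Function.update x i (-x j)) j (-x i)) ∧
           (ℓ = fun x => x i + x j)) :=
      ⟨0, 1, by decide, Or.inr (Or.inl ⟨rfl, rfl⟩)⟩
    have hx : (Pi.single 0 ((a : ℤ) + 1) : Site 3) ∈ box 3 L :=
      axisSite_int_mem_box (by omega) (by omega)
    have hy : (Pi.single 0 ((a : ℤ) + 2) : Site 3) ∈ box 3 L :=
      axisSite_int_mem_box (by omega) (by omega)
    have h := hE.rp_pair hθ hx hy (by simp [hℓdef]; omega) (by simp [hℓdef]; omega)
      (E {0, Pi.single 0 ((n + 1 : ℕ) : ℤ)}) (-E {0, Pi.single 0 (n : ℤ)})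
    have e1 : θ (Pi.single 0 ((a : ℤ) + 1)) = Pi.single 0 (1 - ((a : ℤ) + 1)) := bondMirror_apply_axisSite _
    have e2 : θ (Pi.single 0 ((a : ℤ) + 2)) = Pi.single 0 (1 - ((a : ℤ) + 2)) := bondMirror_apply_axisSite _
    rw [e1, e2,
      Current.symmDiff_singleton_eq_pair (axisSite_int_ne (by omega)),
      Current.symmDiff_singleton_eq_pair (axisSite_int_ne (by omega)),
      Current.symmDiff_singleton_eq_pair (axisSite_int_ne (by omega)),
      Current.symmDiff_singleton_eq_pair (axisSite_int_ne (by omega)),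
      hE.axisPair_eq (by omega) (by omega) (by omega) (by omega) (by omega) (by omega),
      hE.axisPair_eq (by omega) (by omega) (by omega) (by omega) (by omega) (by omega),
      hE.axisPair_eq (by omega) (by omega) (by omega) (by omega) (by omega) (by omega),
      hE.axisPair_eq (by omega) (by omega) (by omega) (by omega) (by omega) (by omega)]
      at h
    have c1 : (a : ℤ) + 1 - (1 - ((a : ℤ) + 1)) = (n : ℤ) := by omega
    have c2 : (a : ℤ) + 1 - (1 - ((a : ℤ) + 2)) = ((n + 1 : ℕ) : ℤ) := by push_cast; omega
    have c3 : (a : ℤ) + 2 - (1 - ((a : ℤ) + 1)) = ((n + 1 : ℕ) : ℤ) := by push_cast; omega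
    have c4 : (a : ℤ) + 2 - (1 - ((a : ℤ) + 2)) = ((n + 2 : ℕ) : ℤ) := by push_cast; omega
    rw [c1, c2, c3, c4] at h
    exact sq_le_mul_of_psd_two hpos h

/-- **One-step axis ratios of a feasible functional are non-decreasing**: for `1 ≤ n`,
`n + 2 ≤ L`, `E{0,(n+1)e₁}/E{0,n e₁} ≤ E{0,(n+2)e₁}/E{0,(n+1)e₁}` (log-convexity divided by the
positive values). [cite: FrohlichIsraelLiebSimon1978, Thm. 2.1] -/
theorem LatticeBootstrapFeasible.axis_ratio_mono {L : ℕ} {cw Cw : ℝ} {E : Finset (Site 3) → ℝ}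
    (hE : LatticeBootstrapFeasible L cw Cw E) (hcw : 0 < cw) {n : ℕ} (hn : 1 ≤ n)
    (hnL : n + 2 ≤ L) :
    E {0, Pi.single 0 ((n + 1 : ℕ) : ℤ)} / E {0, Pi.single 0 (n : ℤ)} ≤
      E {0, Pi.single 0 ((n + 2 : ℕ) : ℤ)} / E {0, Pi.single 0 ((n + 1 : ℕ) : ℤ)} := by
  have h0 : 0 < E {0, Pi.single 0 (n : ℤ)} :=
    hE.twoPoint_pos hcw (axisSite_int_mem_box (by omega) (by omega)) (by rw [Ne, ← Pi.single_zero (0 : Fin 3)]; exact axisSite_int_ne (by omega))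
  have h1 : 0 < E {0, Pi.single 0 ((n + 1 : ℕ) : ℤ)} :=
    hE.twoPoint_pos hcw (axisSite_int_mem_box (by omega) (by omega))
      (by rw [Ne, ← Pi.single_zero (0 : Fin 3)]; exact axisSite_int_ne (by omega))
  rw [div_le_div_iff₀ h0 h1, ← sq, mul_comm]
  exact hE.axis_logConvex hcw hn hnL

end Literature.Probability.LatticeModels
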